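import Summits.CriticalPhenomena.PercolationContinuityZ3.Theorems.Transplant.SkelNegBParamsRootArith
import HarnessLib

/-!
# N1 params, chain of record `NegB`, part RootArithP: THE INTEGER ARITHMETIC OF THE ROOT RUN'S FINE READINGS, PRISM PART — the run prism's fine image lies in
# the root world `[−5r₀ + 1, 25r₀ − 1] × [±(5r₁ − 2)]` (p3's `hPf₁/hPf₂/hPf₃`), generic lemmas in the literal hypothesis shapes (see part RootArith for units)

builds on p205010 (kernel theorem, internal audit signed; external expert review pending) — nothing in this file uses p205010; NOTHING is claimed about
the node `SamePDropOfSkeletonNeg₁` (OPEN).  Pure arithmetic; no definitions.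
Lane `prim-bschramm-*`, seat `prim-bschramm-stmt` (gen 14); helper file (`--supports stmt-CriticalPhenomena-4575 --as helper`); ledger HOME/prim-bschramm-stmt/NEG-PARAMS.md v0.13.
* `prism_B` (`2su(L+1) ≤ 9m`, `2|B| ≤ 9mn`), **`prism_pos`**, **`prism_neg`**, **`trans_prism`**.
[cite: KozmaNitzan2024, §4 p. 28 ((32) at the root), Lemma 11 (p. 22)] [cite: MartineauTassion2017, §4.3 Lemma 4.2]
-/

namespace Summit.CriticalPhenomena.PercolationContinuityZ3.Theorems.Transplant

namespace PlanarSkeletonNeg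

namespace NegB

namespace RootArith

/-- The window terms over the prism: `2su(L+1) ≤ 9m`, `2|B| ≤ 9mn` (`L = W + (N+1)RA′ + Lb`). [folklore] -/
theorem prism_B {m n su v ℓ W RA Lb N : ℤ} (hn : 1 ≤ n) (hm : n * (ℓ - 1) < m) (hsu : n ≤ su) (hsu' : su ≤ 11 * n) (hv : |v| ≤ n)
    (hW : su * W ≤ n * ℓ + su) (hW0 : 0 ≤ W) (hLb : su * Lb ≤ 3 * (n * ℓ) + su) (hLb0 : 0 ≤ Lb) (hRA : 0 ≤ RA) (hRAℓ : 22000 * (RA + 2) ≤ ℓ)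
    (hN : 0 ≤ N) (hN' : N + 1 ≤ 1000) :
    2 * (su * (W + (N + 1) * RA + Lb + 1)) ≤ 9 * m ∧
    2 * |max (v * (su * (-(W + (N + 1) * RA + Lb) - 1))) (v * (su * (W + (N + 1) * RA + Lb) + su - 1))| ≤ 9 * m * n ∧
      2 * |min (v * (su * (-(W + (N + 1) * RA + Lb) - 1))) (v * (su * (W + (N + 1) * RA + Lb) + su - 1))| ≤ 9 * m * n := by
  have hn0 : 0 < n := by linarith
  have hNR : 0 ≤ (N + 1) * RA := by positivity
  set L := W + (N + 1) * RA + Lb with hLdef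
  have hL0 : 0 ≤ L := by rw [hLdef]; positivity
  obtain ⟨hBmax, hBmin⟩ := B_bounds (v := v) (su := su) (L := L) (by linarith) hL0
  have hℓ0 : 0 ≤ ℓ := by linarith
  have hsuL : su * (L + 1) ≤ 4 * (n * ℓ) + 33 * n + 11000 * n * RA := by
    have h0 : (N + 1) * RA ≤ 1000 * RA := mul_le_mul_of_nonneg_right hN' hRA
    have h1 : su * ((N + 1) * RA) ≤ (11 * n) * (1000 * RA) := mul_le_mul hsu' h0 hNR (by positivity)
    rw [hLdef]; linarith
  have h2X : 2 * (4 * (n * ℓ) + 33 * n + 11000 * n * RA) ≤ 9 * m := by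
    have hℓ' : 75 + 22000 * RA ≤ ℓ := by linarith
    have h1 := mul_le_mul_of_nonneg_left hℓ' hn0.le
    linarith
  have hsu0 : 0 ≤ su := by linarith
  have hvs : |v| * (su * (L + 1)) ≤ n * (4 * (n * ℓ) + 33 * n + 11000 * n * RA) :=
    mul_le_mul hv hsuL (by positivity) (by positivity)
  have h3 := mul_le_mul_of_nonneg_left h2X hn0.le
  refine ⟨by linarith, by linarith, by linarith⟩

/-- **PRISM ALONG, `σ = 1`**: the run prism's fine reading inside `[−5r₀ + 1, 25r₀ − 1]` (`r₀ = 40u`). [cite: KozmaNitzan2024, §4 p. 28] -/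
theorem prism_pos {u m n su v ℓ W RA Lb q N Λ : ℤ} (hu : 1 ≤ u) (hn : 1 ≤ n) (hm : n * (ℓ - 1) < m) (hsu : n ≤ su) (hsu' : su ≤ 11 * n)
    (hv : |v| ≤ n) (hW : su * W ≤ n * ℓ + su) (hW0 : 0 ≤ W) (hLb : su * Lb ≤ 3 * (n * ℓ) + su) (hLb0 : 0 ≤ Lb)
    (hRA : 0 ≤ RA) (hRAn : 2000 * (RA + 2) ≤ n) (hRAℓ : 22000 * (RA + 2) ≤ ℓ)
    (hq : 0 ≤ q) (hq' : 4 * q ≤ n) (hN : 0 ≤ N) (hN' : N + 1 ≤ 1000) (hΛ : |Λ| ≤ 3 * m)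
    (hcen : |(800 * u * (800 * Λ) + 640000 * m / 2) / (640000 * m) + u * (N + 1) - 800 * u| ≤ u) :
    -(5 * (40 * u)) + 1 ≤ (800 * u * (800 * Λ) + 640000 * m / 2) / (640000 * m) +
        (800 * u * (800 * (m * (min (1 * (-q - (N + 1) * RA - n)) (1 * (N * n + q + (N + 1) * RA + n))) -
          max (v * (su * (min (1 * (-(W + (N + 1) * RA + Lb))) (1 * (W + (N + 1) * RA + Lb)) - 1))) (v * (su * (max (1 * (-(W + (N + 1) * RA + Lb))) (1 * (W + (N + 1) * RA + Lb))) + su - 1))) / n)) /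
          (640000 * m) ∧
      (800 * u * (800 * Λ) + 640000 * m / 2) / (640000 * m) +
        (800 * u * (800 * (m * (max (1 * (-q - (N + 1) * RA - n)) (1 * (N * n + q + (N + 1) * RA + n))) -
          min (v * (su * (min (1 * (-(W + (N + 1) * RA + Lb))) (1 * (W + (N + 1) * RA + Lb)) - 1))) (v * (su * (max (1 * (-(W + (N + 1) * RA + Lb))) (1 * (W + (N + 1) * RA + Lb))) + su - 1))) / n)) /
          (640000 * m) + 1 ≤ 25 * (40 * u) - 1 := by
  have hm0 : 0 < m := by nlinarith
  have hn0 : 0 < n := by linarith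
  have hu0 : 0 ≤ u := by linarith
  have hNR : 0 ≤ (N + 1) * RA := by positivity
  have hqr : 4 * (q + (N + 1) * RA) ≤ 3 * n := by nlinarith
  set L := W + (N + 1) * RA + Lb with hLdef
  have hL0 : 0 ≤ L := by rw [hLdef]; positivity
  simp only [one_mul]
  rw [min_eq_left (by nlinarith : -q - (N + 1) * RA - n ≤ N * n + q + (N + 1) * RA + n),
    max_eq_right (by nlinarith : -q - (N + 1) * RA - n ≤ N * n + q + (N + 1) * RA + n),
    min_eq_left (by linarith : -L ≤ L), max_eq_right (by linarith : -L ≤ L)]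
  obtain ⟨-, hBx, hBn⟩ := prism_B (v := v) hn hm hsu hsu' hv hW hW0 hLb hLb0 hRA hRAℓ hN hN'
  set Bmax := max (v * (su * (-L - 1))) (v * (su * L + su - 1))
  set Bmin := min (v * (su * (-L - 1))) (v * (su * L + su - 1))
  obtain ⟨f1, f2⟩ := coarse_bounds (u := u) (Λ := Λ) hm0
  set F := (800 * u * (800 * Λ) + 640000 * m / 2) / (640000 * m)
  obtain ⟨hΛ1, hΛ2⟩ := abs_le.1 hΛ
  have hFlo : -3 * u ≤ F := by
    by_contra hc; push Not at hc
    have h1 : 2 * m * F ≤ 2 * m * (-3 * u - 1) := mul_le_mul_of_nonneg_left (by linarith) (by positivity)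
    nlinarith
  have hcen' := abs_le.1 hcen
  constructor
  · obtain ⟨-, g2⟩ := incr_bounds (u := u) (m := m) (n := n) (a := -q - (N + 1) * RA - n) (B := Bmax) hu0 hm0 hn0
    set G := 800 * u * (800 * (m * (-q - (N + 1) * RA - n) - Bmax) / n) / (640000 * m)
    have e1 : u * (4 * (m * (-q - (N + 1) * RA - n))) ≥ u * (-(7 * m * n)) := by
      refine mul_le_mul_of_nonneg_left ?_ hu0
      have := mul_le_mul_of_nonneg_left hqr hm0.le
      linarith
    have e2 : 2 * (u * Bmax) ≤ 9 * u * m * n := by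
      have h1 : u * Bmax ≤ u * |Bmax| := mul_le_mul_of_nonneg_left (le_abs_self _) hu0
      have h2 := mul_le_mul_of_nonneg_left hBx hu0
      linarith
    have key : 800 * m * n * (G + 7 * u + 1) ≥ 600 * u * m * n - u * n := by linarith
    have hX : 0 ≤ G + 7 * u + 1 := by
      by_contra hc; push Not at hc
      have h1 : 800 * m * n * (G + 7 * u + 1) ≤ 800 * m * n * (-1) := mul_le_mul_of_nonneg_left (by linarith) (by positivity)
      have h2 : 0 ≤ u * n * (600 * m - 1) := mul_nonneg (mul_nonneg hu0 hn0.le) (by linarith)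
      have hmn : 0 < m * n := mul_pos hm0 hn0
      nlinarith
    linarith
  · obtain ⟨g1, -⟩ := incr_bounds (u := u) (m := m) (n := n) (a := N * n + q + (N + 1) * RA + n) (B := Bmin) hu0 hm0 hn0
    set G := 800 * u * (800 * (m * (N * n + q + (N + 1) * RA + n) - Bmin) / n) / (640000 * m)
    have e1 : u * (4 * (m * (N * n + q + (N + 1) * RA + n))) ≤ u * (4 * m * n * N + 7 * m * n) := by
      refine mul_le_mul_of_nonneg_left ?_ hu0
      have := mul_le_mul_of_nonneg_left hqr hm0.le
      linarith
    have e2 : 2 * (u * (-Bmin)) ≤ 9 * u * m * n := by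
      have h1 : u * (-Bmin) ≤ u * |Bmin| := mul_le_mul_of_nonneg_left (neg_le_abs _) hu0
      have h2 := mul_le_mul_of_nonneg_left hBn hu0
      linarith
    have key : 4 * (m * n * G) ≤ 4 * u * m * n * N + 25 * u * m * n := by linarith
    have hX : G ≤ u * N + 7 * u - 1 := by
      by_contra hc; push Not at hc
      have h1 : 4 * (m * n) * (u * N + 7 * u) ≤ 4 * (m * n) * G := mul_le_mul_of_nonneg_left (by linarith) (by positivity)
      have h2 : 0 < u * m * n := mul_pos (mul_pos (by linarith) hm0) hn0
      nlinarith
    linarith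

/-- **PRISM ALONG, `σ = −1`** (mirror). [cite: KozmaNitzan2024, §4 p. 28] -/
theorem prism_neg {u m n su v ℓ W RA Lb q N Λ : ℤ} (hu : 1 ≤ u) (hn : 1 ≤ n) (hm : n * (ℓ - 1) < m) (hsu : n ≤ su) (hsu' : su ≤ 11 * n)
    (hv : |v| ≤ n) (hW : su * W ≤ n * ℓ + su) (hW0 : 0 ≤ W) (hLb : su * Lb ≤ 3 * (n * ℓ) + su) (hLb0 : 0 ≤ Lb)
    (hRA : 0 ≤ RA) (hRAn : 2000 * (RA + 2) ≤ n) (hRAℓ : 22000 * (RA + 2) ≤ ℓ)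
    (hq : 0 ≤ q) (hq' : 4 * q ≤ n) (hN : 0 ≤ N) (hN' : N + 1 ≤ 1000) (hΛ : |Λ| ≤ 3 * m)
    (hcen : |(800 * u * (800 * Λ) + 640000 * m / 2) / (640000 * m) - u * (N + 1) + 800 * u| ≤ u) :
    -(5 * (40 * u)) + 1 ≤ -((800 * u * (800 * Λ) + 640000 * m / 2) / (640000 * m) +
        (800 * u * (800 * (m * (max ((-1) * (-q - (N + 1) * RA - n)) ((-1) * (N * n + q + (N + 1) * RA + n))) -
          min (v * (su * (min ((-1) * (-(W + (N + 1) * RA + Lb))) ((-1) * (W + (N + 1) * RA + Lb)) - 1))) (v * (su * (max ((-1) * (-(W + (N + 1) * RA + Lb))) ((-1) * (W + (N + 1) * RA + Lb))) + su - 1))) / n)) /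
          (640000 * m) + 1) ∧
      -((800 * u * (800 * Λ) + 640000 * m / 2) / (640000 * m) +
        (800 * u * (800 * (m * (min ((-1) * (-q - (N + 1) * RA - n)) ((-1) * (N * n + q + (N + 1) * RA + n))) -
          max (v * (su * (min ((-1) * (-(W + (N + 1) * RA + Lb))) ((-1) * (W + (N + 1) * RA + Lb)) - 1))) (v * (su * (max ((-1) * (-(W + (N + 1) * RA + Lb))) ((-1) * (W + (N + 1) * RA + Lb))) + su - 1))) / n)) /
          (640000 * m)) ≤ 25 * (40 * u) - 1 := by
  have hm0 : 0 < m := by nlinarith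
  have hn0 : 0 < n := by linarith
  have hu0 : 0 ≤ u := by linarith
  have hNR : 0 ≤ (N + 1) * RA := by positivity
  have hqr : 4 * (q + (N + 1) * RA) ≤ 3 * n := by nlinarith
  set L := W + (N + 1) * RA + Lb with hLdef
  have hL0 : 0 ≤ L := by rw [hLdef]; positivity
  simp only [neg_mul, one_mul, neg_neg]
  rw [max_eq_left (by nlinarith : -(N * n + q + (N + 1) * RA + n) ≤ -(-q - (N + 1) * RA - n)),
    min_eq_right (by nlinarith : -(N * n + q + (N + 1) * RA + n) ≤ -(-q - (N + 1) * RA - n)),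
    min_eq_right (by linarith : -L ≤ L), max_eq_left (by linarith : -L ≤ L)]
  obtain ⟨-, hBx, hBn⟩ := prism_B (v := v) hn hm hsu hsu' hv hW hW0 hLb hLb0 hRA hRAℓ hN hN'
  set Bmax := max (v * (su * (-L - 1))) (v * (su * L + su - 1))
  set Bmin := min (v * (su * (-L - 1))) (v * (su * L + su - 1))
  obtain ⟨f1, f2⟩ := coarse_bounds (u := u) (Λ := Λ) hm0
  set F := (800 * u * (800 * Λ) + 640000 * m / 2) / (640000 * m)
  obtain ⟨hΛ1, hΛ2⟩ := abs_le.1 hΛ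
  have hFhi : F ≤ 3 * u := by
    by_contra hc; push Not at hc
    have h1 : 2 * m * (3 * u + 1) ≤ 2 * m * F := mul_le_mul_of_nonneg_left (by linarith) (by positivity)
    nlinarith
  have hcen' := abs_le.1 hcen
  constructor
  · -- −PHI ≥ −200u + 1: G' := G(q + (N+1)RA + n, Bmin) ≤ 7u − 1
    obtain ⟨g1, -⟩ := incr_bounds (u := u) (m := m) (n := n) (a := -(-q - (N + 1) * RA - n)) (B := Bmin) hu0 hm0 hn0
    set G := 800 * u * (800 * (m * -(-q - (N + 1) * RA - n) - Bmin) / n) / (640000 * m)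
    have e1 : u * (4 * (m * -(-q - (N + 1) * RA - n))) ≤ u * (7 * m * n) := by
      refine mul_le_mul_of_nonneg_left ?_ hu0
      have := mul_le_mul_of_nonneg_left hqr hm0.le
      linarith
    have e2 : 2 * (u * (-Bmin)) ≤ 9 * u * m * n := by
      have h1 : u * (-Bmin) ≤ u * |Bmin| := mul_le_mul_of_nonneg_left (neg_le_abs _) hu0
      have h2 := mul_le_mul_of_nonneg_left hBn hu0
      linarith
    have key : 4 * (m * n * G) ≤ 25 * u * m * n := by linarith
    have hX : G ≤ 7 * u - 1 := by
      by_contra hc; push Not at hc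
      have h1 : 4 * (m * n) * (7 * u) ≤ 4 * (m * n) * G := mul_le_mul_of_nonneg_left (by linarith) (by positivity)
      have h2 : 0 < u * m * n := mul_pos (mul_pos (by linarith) hm0) hn0
      nlinarith
    linarith
  · -- −PLO ≤ 1000u − 1: G := G(−(Nn + q + (N+1)RA + n), Bmax) ≥ −uN − 7u − 1
    obtain ⟨-, g2⟩ := incr_bounds (u := u) (m := m) (n := n) (a := -(N * n + q + (N + 1) * RA + n)) (B := Bmax) hu0 hm0 hn0
    set G := 800 * u * (800 * (m * -(N * n + q + (N + 1) * RA + n) - Bmax) / n) / (640000 * m)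
    have e1 : u * (4 * (m * -(N * n + q + (N + 1) * RA + n))) ≥ u * (-(4 * m * n * N) - 7 * m * n) := by
      refine mul_le_mul_of_nonneg_left ?_ hu0
      have := mul_le_mul_of_nonneg_left hqr hm0.le
      linarith
    have e2 : 2 * (u * Bmax) ≤ 9 * u * m * n := by
      have h1 : u * Bmax ≤ u * |Bmax| := mul_le_mul_of_nonneg_left (le_abs_self _) hu0
      have h2 := mul_le_mul_of_nonneg_left hBx hu0
      linarith
    have key : 800 * m * n * (G + u * N + 7 * u + 1) ≥ 600 * u * m * n - u * n := by linarith
    have hX : 0 ≤ G + u * N + 7 * u + 1 := by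
      by_contra hc; push Not at hc
      have h1 : 800 * m * n * (G + u * N + 7 * u + 1) ≤ 800 * m * n * (-1) := mul_le_mul_of_nonneg_left (by linarith) (by positivity)
      have h2 : 0 ≤ u * n * (600 * m - 1) := mul_nonneg (mul_nonneg hu0 hn0.le) (by linarith)
      have hmn : 0 < m * n := mul_pos hm0 hn0
      nlinarith
    linarith

/-- **PRISM ACROSS, either `σ`**: inside `±(5r₁ − 2)` (`r₁ = 40u`, `|Λ₁| ≤ 2m`). [cite: KozmaNitzan2024, §4 p. 28] -/
theorem trans_prism {u m n su v ℓ W RA Lb N Λ σ : ℤ} (hu : 1 ≤ u) (hn : 1 ≤ n) (hm : n * (ℓ - 1) < m) (hsu : n ≤ su) (hsu' : su ≤ 11 * n)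
    (hv : |v| ≤ n) (hW : su * W ≤ n * ℓ + su) (hW0 : 0 ≤ W) (hLb : su * Lb ≤ 3 * (n * ℓ) + su) (hLb0 : 0 ≤ Lb) (hRA : 0 ≤ RA)
    (hRAℓ : 22000 * (RA + 2) ≤ ℓ) (hN : 0 ≤ N) (hN' : N + 1 ≤ 1000) (hσ : σ = 1 ∨ σ = -1) (hΛ : |Λ| ≤ 2 * m) :
    -(5 * (40 * u) - 2) ≤ (800 * u * (800 * Λ) + 640000 * m / 2) / (640000 * m) +
        (800 * u * (800 * (su * (min (σ * (-(W + (N + 1) * RA + Lb))) (σ * (W + (N + 1) * RA + Lb)) - 1)))) / (640000 * m) ∧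
      (800 * u * (800 * Λ) + 640000 * m / 2) / (640000 * m) +
        (800 * u * (800 * (su * (max (σ * (-(W + (N + 1) * RA + Lb))) (σ * (W + (N + 1) * RA + Lb))) + su - 1))) / (640000 * m) + 1 ≤
        5 * (40 * u) - 2 := by
  have hm0 : 0 < m := by nlinarith
  have hn0 : 0 < n := by linarith
  have hu0 : 0 ≤ u := by linarith
  have hNR : 0 ≤ (N + 1) * RA := by positivity
  set L := W + (N + 1) * RA + Lb with hLdef
  have hL0 : 0 ≤ L := by rw [hLdef]; positivity
  have hmin : min (σ * -L) (σ * L) = -L := by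
    rcases hσ with rfl | rfl
    · simp only [one_mul]; exact min_eq_left (by linarith)
    · simp only [neg_mul, one_mul, neg_neg]; exact min_eq_right (by linarith)
  have hmax : max (σ * -L) (σ * L) = L := by
    rcases hσ with rfl | rfl
    · simp only [one_mul]; exact max_eq_right (by linarith)
    · simp only [neg_mul, one_mul, neg_neg]; exact max_eq_left (by linarith)
  rw [hmin, hmax]
  obtain ⟨hsL, -, -⟩ := prism_B (v := v) hn hm hsu hsu' hv hW hW0 hLb hLb0 hRA hRAℓ hN hN'
  obtain ⟨f1, f2⟩ := coarse_bounds (u := u) (Λ := Λ) hm0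
  set F := (800 * u * (800 * Λ) + 640000 * m / 2) / (640000 * m)
  obtain ⟨hΛ1, hΛ2⟩ := abs_le.1 hΛ
  have hF : -2 * u ≤ F ∧ F ≤ 2 * u := by
    constructor
    · by_contra hc; push Not at hc
      have h1 : 2 * m * F ≤ 2 * m * (-2 * u - 1) := mul_le_mul_of_nonneg_left (by linarith) (by positivity)
      nlinarith
    · by_contra hc; push Not at hc
      have h1 : 2 * m * (2 * u + 1) ≤ 2 * m * F := mul_le_mul_of_nonneg_left (by linarith) (by positivity)
      nlinarith
  constructor
  · obtain ⟨-, t2⟩ := trans_bounds (u := u) (m := m) (X := su * (-L - 1)) hm0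
    set H := 800 * u * (800 * (su * (-L - 1))) / (640000 * m)
    have e : 2 * (u * (su * (-L - 1))) ≥ -(9 * u * m) := by
      have := mul_le_mul_of_nonneg_left hsL hu0; linarith
    have hX : -5 * u - 1 ≤ H := by
      by_contra hc; push Not at hc
      have h1 : m * H ≤ m * (-5 * u - 2) := mul_le_mul_of_nonneg_left (by linarith) hm0.le
      nlinarith
    linarith
  · obtain ⟨t1, -⟩ := trans_bounds (u := u) (m := m) (X := su * L + su - 1) hm0
    set H := 800 * u * (800 * (su * L + su - 1)) / (640000 * m)
    have e : 2 * (u * (su * L + su - 1)) ≤ 9 * u * m := by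
      have := mul_le_mul_of_nonneg_left hsL hu0; nlinarith
    have hX : H ≤ 5 * u := by
      by_contra hc; push Not at hc
      have h1 : m * (5 * u + 1) ≤ m * H := mul_le_mul_of_nonneg_left (by linarith) hm0.le
      nlinarith
    linarith

end RootArith

end NegB

end PlanarSkeletonNeg

end Summit.CriticalPhenomena.PercolationContinuityZ3.Theorems.Transplant
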